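import Literature.Probability.RandomPlanarGeometry.HexSAWStripBetaCoefficientLaw
import Literature.Probability.RandomPlanarGeometry.HexSAWStripSurfaceCoeffIdentity
import HarnessLib

/-!
# The coefficient law of the ARCH series of the honeycomb strip at the threshold: `α_{T,m} · y_T^m → Λ_T (1 − y*/y_T)/(√2 cos(3π/8))`
# (module «ARCH-COEFF»)

Topic `Literature/Probability/RandomPlanarGeometry` (continues «BETA-COEFF» `HexSAWStripBetaCoefficientLaw.lean` — `β_{T,m} · y_T^m → Λ_T > 0`
and the residue of `B_T(x_c; ·)` — and the coefficient identity `HexSAWStripSurfaceCoeffIdentity.lean`: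
`HV.stripBcoeff_sub_yStar_mul_succ`, `β_{T,m} − y*·β_{T,m+1} = √2 cos(3π/8) · α_{T,m}` for `m ≥ 1`, the printed identity (16) of
Beaton–Bousquet-Mélou–de Gier–Duminil-Copin–Guttmann read coefficientwise in the box limit; `HexSAWStripSurfaceThresholdRate.lean` —
`HV.stripAcoeff T m = α_{T,m}`, `HV.stripAyLim_eq_tsum_of_lt_stripYT : A_T(x_c; y) = Σ_m α_{T,m} y^m` below `y_T`, `HV.yStar_lt_stripYT`).
Lane «pcv-sawmu» (CriticalPhenomena venture), a-p2 g21.  Sources of the SETTING: N. R. Beaton, M. Bousquet-Mélou, J. de Gier,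
H. Duminil-Copin, A. J. Guttmann, CMP 326 (2014), arXiv:1109.0358v5: §2 eq. (10) (the arch series `A_{T,L}(x; y)` of walks from `a`
back to the bottom boundary `α`), §4.1 eq. (16) (`cos(3π/8) A_{T,L} + cos(π/4) E_{T,L} + β(y) B_{T,L} = 1` at `x = x_c`), Corollary 8
(arXiv v5 p. 12: `A_T(x_c; ·)` and `B_T(x_c; ·)` have the same radius `y_T`); `y* = 1 + √2`.  Nothing printed states a coefficient
asymptotic for `A_T(x_c; ·)`; in print one would read the pole off the rational transfer-matrix series — not used here.

## What is proved (namespace `Literature.Probability.RandomPlanarGeometry.SAW.HV`; `y_T = stripYT T`, `y* = yStar`, `T ≥ 2`)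

* ★★★ `exists_tendsto_stripAcoeff_mul_pow` — with the `Λ > 0` of «BETA-COEFF» (`β_{T,m} y_T^m → Λ`):
  `α_{T,m} · y_T^m ⟶ Λ · (1 − y*/y_T) / (√2 cos(3π/8))` — the arches with `m` surface contacts decay EXACTLY like `y_T^{−m}`, with a
  constant tied to the bridges' by the coefficient identity (`β_{T,m} − y*β_{T,m+1} = √2 cos(3π/8) α_{T,m}`, and `y* < y_T`);
* ★★★ `exists_pos_tendsto_stripAcoeff_mul_pow` — `∃ Λ_A > 0, α_{T,m} y_T^m → Λ_A`;
* ★★ `tendsto_stripAcoeff_div_stripBcoeff` — `α_{T,m} / β_{T,m} ⟶ (1 − y*/y_T)/(√2 cos(3π/8))`: at the threshold a fixed asymptotic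
  PROPORTION of the critical walks with many surface contacts returns to the bottom boundary;
* ★★ `tendsto_stripAcoeff_succ_div` — `α_{T,m+1}/α_{T,m} → 1/y_T`;
* ★★★ `exists_tendsto_sub_mul_stripAyLim` — the RESIDUE of the arch series: `(y_T − y) · A_T(x_c; y) ⟶ Λ_A · y_T` as `y ↑ y_T`.

Label: LANE THEOREM (own result of lane «pcv-sawmu», a-p2 g21, 2026-08-26); a corollary of «BETA-COEFF» and the printed identity (16).
NOT claimed: `T = 1`, uniformity in `T`, a rate, the value of `Λ` in closed form, anything about `E_T` at `y_T`.
-/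

noncomputable section

open Finset Filter Topology Literature.Probability.LatticeModels Literature.Probability.Percolation

namespace Literature.Probability.RandomPlanarGeometry.SAW

namespace HV

variable {T : ℕ}

/-- `κ := √2 · cos(3π/8) > 0` and `0 < 1 − y*/y_T` (`T ≥ 1`) (plumbing for the constants).
[cite: BeatonBousquetMelouDeGierDuminilCopinGuttmann2014, §4.1 eq. (16) and §4.2 (arXiv v5 pp. 13–14: y* ≤ y_T); lane] -/
theorem archConst_pos (hT : 1 ≤ T) :
    0 < Real.sqrt 2 * Real.cos (3 * Real.pi / 8) ∧ 0 < 1 - yStar / stripYT T := by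
  refine ⟨sqrt_two_mul_cos_three_pi_div_eight_pos, ?_⟩
  have hy := yStar_lt_stripYT hT
  have hy0 : 0 < stripYT T := yStar_pos.trans hy
  rw [sub_pos, div_lt_one hy0]
  exact hy

/-- ★★★ **THE COEFFICIENT LAW OF THE ARCH SERIES `A_T(x_c; ·)` AT THE THRESHOLD** (`T ≥ 2`): with the constant `Λ > 0` of the
β-coefficient law (`β_{T,m} · y_T^m → Λ`, «BETA-COEFF»),
`α_{T,m} · y_T^m ⟶ Λ · (1 − y*/y_T) / (√2 cos(3π/8))`,
where `α_{T,m}` is the `x_c`-weighted number of arches of the width-`T` honeycomb strip (walks from the mid-edge `a` back to the bottom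
boundary) with exactly `m` surface contacts.  From the coefficient identity `β_{T,m} − y*·β_{T,m+1} = √2 cos(3π/8)·α_{T,m}`:
`α_{T,m} y_T^m = (β_{T,m} y_T^m − (y*/y_T)·β_{T,m+1} y_T^{m+1})/(√2 cos(3π/8))`.
[cite: BeatonBousquetMelouDeGierDuminilCopinGuttmann2014, §4.1 eq. (16) (arXiv v5 p. 13), Corollary 8 (p. 12); lane «pcv-sawmu», a-p2 g21 — own result] -/
theorem exists_tendsto_stripAcoeff_mul_pow (hT : 2 ≤ T) :
    ∃ Λ : ℝ, 0 < Λ ∧ Tendsto (fun m : ℕ => stripBcoeff T m * stripYT T ^ m) atTop (𝓝 Λ) ∧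
      Tendsto (fun m : ℕ => stripAcoeff T m * stripYT T ^ m) atTop
        (𝓝 (Λ * (1 - yStar / stripYT T) / (Real.sqrt 2 * Real.cos (3 * Real.pi / 8)))) := by
  have hT1 : 1 ≤ T := by omega
  obtain ⟨Λ, hΛ, hB⟩ := exists_pos_tendsto_stripBcoeff_mul_pow hT
  obtain ⟨hκ, _⟩ := archConst_pos hT1
  set κ : ℝ := Real.sqrt 2 * Real.cos (3 * Real.pi / 8) with hκdef
  have hy0 : 0 < stripYT T := yStar_pos.trans (yStar_lt_stripYT hT1)
  refine ⟨Λ, hΛ, hB, ?_⟩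
  -- `β_{m+1} y_T^{m+1} → Λ`
  have hB1 : Tendsto (fun m : ℕ => stripBcoeff T (m + 1) * stripYT T ^ (m + 1)) atTop (𝓝 Λ) := hB.comp (tendsto_add_atTop_nat 1)
  have hlim : Tendsto (fun m : ℕ => (stripBcoeff T m * stripYT T ^ m -
      yStar / stripYT T * (stripBcoeff T (m + 1) * stripYT T ^ (m + 1))) / κ) atTop (𝓝 ((Λ - yStar / stripYT T * Λ) / κ)) :=
    (hB.sub (hB1.const_mul _)).div_const κ
  have hval : (Λ - yStar / stripYT T * Λ) / κ = Λ * (1 - yStar / stripYT T) / κ := by ring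
  rw [hval] at hlim
  refine hlim.congr' ?_
  filter_upwards [eventually_ge_atTop 1] with m hm
  have hid := stripBcoeff_sub_yStar_mul_succ hT1 hm
  rw [← hκdef] at hid
  field_simp
  rw [mul_assoc (stripYT T ^ m * stripYT T) κ, ← hid]
  ring

/-- ★★★ Short form: `∃ Λ_A > 0, α_{T,m} · y_T^m → Λ_A` (`T ≥ 2`). [cite: BeatonBousquetMelouDeGierDuminilCopinGuttmann2014, §4.1 eq. (16), Corollary 8; lane «pcv-sawmu», a-p2 g21 — own result] -/
theorem exists_pos_tendsto_stripAcoeff_mul_pow (hT : 2 ≤ T) :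
    ∃ Λ : ℝ, 0 < Λ ∧ Tendsto (fun m : ℕ => stripAcoeff T m * stripYT T ^ m) atTop (𝓝 Λ) := by
  obtain ⟨Λ, hΛ, -, hA⟩ := exists_tendsto_stripAcoeff_mul_pow hT
  obtain ⟨hκ, h1⟩ := archConst_pos (show 1 ≤ T by omega)
  exact ⟨_, div_pos (mul_pos hΛ h1) hκ, hA⟩

/-- ★★ **Arches versus bridges**: `α_{T,m} / β_{T,m} ⟶ (1 − y*/y_T) / (√2 cos(3π/8))` (`T ≥ 2`) — among the critical strip walks
from `a` with many surface contacts, a fixed asymptotic proportion ends on the bottom boundary rather than the top one.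
[cite: BeatonBousquetMelouDeGierDuminilCopinGuttmann2014, §4.1 eq. (16) (arXiv v5 p. 13); lane «pcv-sawmu», a-p2 g21 — own result] -/
theorem tendsto_stripAcoeff_div_stripBcoeff (hT : 2 ≤ T) :
    Tendsto (fun m : ℕ => stripAcoeff T m / stripBcoeff T m) atTop
      (𝓝 ((1 - yStar / stripYT T) / (Real.sqrt 2 * Real.cos (3 * Real.pi / 8)))) := by
  obtain ⟨Λ, hΛ, hB, hA⟩ := exists_tendsto_stripAcoeff_mul_pow hT
  have hy0 : 0 < stripYT T := yStar_pos.trans (yStar_lt_stripYT (show 1 ≤ T by omega))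
  have h := hA.div hB hΛ.ne'
  have hval : Λ * (1 - yStar / stripYT T) / (Real.sqrt 2 * Real.cos (3 * Real.pi / 8)) / Λ =
      (1 - yStar / stripYT T) / (Real.sqrt 2 * Real.cos (3 * Real.pi / 8)) := by
    field_simp
  rw [hval] at h
  refine h.congr fun m => ?_
  simp only [Pi.div_apply]
  rw [mul_div_mul_right _ _ (pow_ne_zero _ hy0.ne')]

/-- ★★ **Ratio law for arches**: `α_{T,m+1} / α_{T,m} → 1/y_T` (`T ≥ 2`). [cite: BeatonBousquetMelouDeGierDuminilCopinGuttmann2014, Corollary 8 (arXiv v5 p. 12: y_T is the radius of A_T(x_c; ·)); lane «pcv-sawmu», a-p2 g21 — own result] -/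
theorem tendsto_stripAcoeff_succ_div (hT : 2 ≤ T) :
    Tendsto (fun m : ℕ => stripAcoeff T (m + 1) / stripAcoeff T m) atTop (𝓝 (stripYT T)⁻¹) := by
  obtain ⟨Λ, hΛ, h⟩ := exists_pos_tendsto_stripAcoeff_mul_pow hT
  have hy : 0 < stripYT T := yStar_pos.trans (yStar_lt_stripYT (show 1 ≤ T by omega))
  have h1 : Tendsto (fun m => stripAcoeff T (m + 1) * stripYT T ^ (m + 1)) atTop (𝓝 Λ) := h.comp (tendsto_add_atTop_nat 1)
  have h2 := (h1.div h hΛ.ne').mul_const (stripYT T)⁻¹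
  rw [div_self hΛ.ne', one_mul] at h2
  refine h2.congr fun m => ?_
  simp only [Pi.div_apply]
  by_cases hb : stripAcoeff T m = 0
  · simp [hb]
  · rw [pow_succ]
    field_simp

/-- ★★★ **The residue of the arch series at the threshold** (`T ≥ 2`): with the same `Λ_A > 0`,
`(y_T − y) · A_T(x_c; y) ⟶ Λ_A · y_T` as `y ↑ y_T` (Abelian step as in «BETA-COEFF»).
[cite: BeatonBousquetMelouDeGierDuminilCopinGuttmann2014, Corollary 8 (arXiv v5 p. 12); Feller1971, XIII.5 Theorem 5 (easy half); lane «pcv-sawmu», a-p2 g21 — own result] -/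
theorem exists_tendsto_sub_mul_stripAyLim (hT : 2 ≤ T) :
    ∃ Λ : ℝ, 0 < Λ ∧ Tendsto (fun m : ℕ => stripAcoeff T m * stripYT T ^ m) atTop (𝓝 Λ) ∧
      Tendsto (fun y : ℝ => (stripYT T - y) * stripAyLim T y) (𝓝[<] stripYT T) (𝓝 (Λ * stripYT T)) := by
  have hT1 : 1 ≤ T := by omega
  obtain ⟨Λ, hΛ, h⟩ := exists_pos_tendsto_stripAcoeff_mul_pow hT
  have hyT := one_lt_stripYT hT1
  have hy : 0 < stripYT T := by linarith
  refine ⟨Λ, hΛ, h, ?_⟩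
  set q : ℕ → ℝ := fun m => stripAcoeff T m * stripYT T ^ m with hq
  have hq0 : ∀ m, 0 ≤ q m := fun m => mul_nonneg (stripAcoeff_nonneg hT1 m) (pow_nonneg hy.le _)
  -- Abelian step: `(1 − s) Σ q_m s^m → Λ` as `s ↑ 1`
  have habel : Tendsto (fun s : ℝ => (1 - s) * ∑' m, q m * s ^ m) (𝓝[<] 1) (𝓝 Λ) := by
    have hces : Tendsto (fun n : ℕ => (∑ k ∈ range n, q k) / (n : ℝ) ^ (1 : ℝ)) atTop (𝓝 (Λ / Real.Gamma (1 + 1))) := by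
      have h2 : Real.Gamma (1 + 1) = 1 := by norm_num [Real.Gamma_two]
      rw [h2, div_one]
      refine h.cesaro.congr fun n => ?_
      rw [Real.rpow_one, div_eq_inv_mul]
    have hA := ((Literature.Analysis.Asymptotics.hardyLittlewood_powerSeries_iff hq0 zero_le_one hΛ).mpr hces).2
    refine hA.congr fun s => ?_
    rw [Real.rpow_one]
  have hsub : Tendsto (fun y : ℝ => y / stripYT T) (𝓝[<] stripYT T) (𝓝[<] 1) := by
    refine tendsto_nhdsWithin_of_tendsto_nhds_of_eventually_within _ ?_ ?_
    · have : Tendsto (fun y : ℝ => y / stripYT T) (𝓝 (stripYT T)) (𝓝 (stripYT T / stripYT T)) := tendsto_id.div_const _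
      rw [div_self hy.ne'] at this
      exact this.mono_left nhdsWithin_le_nhds
    · filter_upwards [self_mem_nhdsWithin] with y hy'
      exact (div_lt_one hy).2 hy'
  have h1 := (habel.comp hsub).mul_const (stripYT T)
  refine h1.congr' ?_
  filter_upwards [Ico_mem_nhdsLT hyT] with y hyI
  have hy0' : 0 ≤ y := zero_le_one.trans hyI.1
  simp only [Function.comp, hq]
  rw [stripAyLim_eq_tsum_of_lt_stripYT hT1 hy0' hyI.2]
  have hterm : ∀ m, stripAcoeff T m * stripYT T ^ m * (y / stripYT T) ^ m = stripAcoeff T m * y ^ m := fun m => by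
    rw [div_pow, mul_assoc, mul_div_assoc', mul_div_cancel_left₀ _ (pow_ne_zero _ hy.ne')]
  simp_rw [hterm]
  field_simp

end HV

end Literature.Probability.RandomPlanarGeometry.SAW
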